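import Literature.Barriers.ABC.UniformABCImpliesNoSiegelZerosProofs
import HarnessLib

/-!
# `OWeakUniformABCImpliesNoSiegelZeros`: fact split (D-0027 A7 exception, batch libsplit-26)

Split file for the XL barrier entry `Literature.Barriers.ABC.OWeakUniformABCImpliesNoSiegelZeros`
(`UniformABCImpliesNoSiegelZeros.lean`; Táfula 2021, Theorem 1.2 / Granville–Stark 2000, Theorem 2
in the `O`-weak form). The sibling `UniformABCImpliesNoSiegelZerosProofs.lean` PROVES the whole
printed argument — the height argument under `O`-weak abc (Táfula Lemma 5.5), Granville–Stark's
eq. (11), Mahler's equivalence, class field theory for the Hilbert class field — down to ONE input of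
complex-multiplication theory, taken there as the hypothesis `H` of
`OWeakUniformABCImpliesNoSiegelZeros.of_discrBoundPoly`. This file names that input as the single
CHILD fact of the split and proves the assembly:

* `GranvilleStarkLemma1Poly` — Granville–Stark 2000, §2 Lemma 1 = Táfula 2021, Lemma 5.4, in the
  weak POLYNOMIAL form the `O`-weak entry consumes: for every imaginary quadratic field `K` with
  `|d_K|` large there are a number field `F`, `σ₀ : F → ℂ` and `u, v ∈ F` with `σ₀(u³) = j(τ_{d_K})`,
  `v² = u³ − 1728` and `|D_F| ≤ (B |d_K|^E)^{[F:ℚ]}` (root discriminant polynomially bounded). In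
  print `F = 𝓛_D = ℚ(γ₂(τ_D), γ₃(τ_D)) ⊇ ℚ(√D, j(τ_D))` (Weber functions `γ₂³ = j`, `γ₃² = j − 1728`)
  with `rd_𝓛 ≤ 6√|D|` (Granville–Stark Lemma 1; "the particular factor of 6 plays little role here,
  since it would be enough to have `rd_𝓛 ≪_ε |D|^{1/2+ε}`", Táfula after Lemma 5.4).
* `OWeakUniformABCImpliesNoSiegelZeros_holds_of` — the parent from the child (PROVED: it is
  `OWeakUniformABCImpliesNoSiegelZeros.of_discrBoundPoly`).

Why this child and not the later in-tree frontier `….of_cubeSquare_singularModuliField_two_three`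
(ideal cube/square shape of `(j₁)`, `(j₁ − 1728)` in `𝓞_{H_K}` for `2 ∣ d_K` or `3 ∣ d_K`): at the
primes of `H_K` above `3` (resp. `2`), where `E_{τ_D}` has supersingular reduction with `j ≡ 0 = 1728`,
the exponent of `(j₁)` (resp. `(j₁ − 1728)`) is not forced to be divisible by `3` (resp. `2`) by the
ramified extension `H_K(γ₂)/H_K` (resp. `H_K(γ₃)/H_K`), so that hypothesis is not evidently a
theorem; the field-with-elements form above is literally what the sources prove. The sharper
verbatim form with constant `6√|d_K|` is the hypothesis of `….of_cmInput`, shared with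
`granville_stark_of_cmInput` / `granville_stark_noSiegelZeros_of_cmInput`
(`Literature/NumberTheory/DiophantineGeometry`): one proof of it discharges all three facts.

## References

* [Tafula2021] C. Táfula, Acta Arith. 201 (2021) 1–28 (arXiv:1911.07215): Theorem 1.2, §5.2
  Lemma 5.4 and the remark after it, Lemma 5.5.
* [GranvilleStark2000] A. Granville, H. M. Stark, Invent. Math. 139 (2000) 509–523: §1, §2 Lemma 1.
* [Cox2013] D. A. Cox, Primes of the form x² + ny², 2nd ed. (2013): Thm. 11.1, Thm. 12.2 (Weber
  functions `γ₂`, `γ₃` and the ring class fields they generate).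
-/

noncomputable section

namespace Literature.Barriers.ABC

open Literature.NumberTheory.DiophantineGeometry
open _root_.Literature.NumberTheory.EllipticCurves
open _root_.Literature.NumberTheory.QuadraticFields.BinaryQuadraticForm
open scoped NumberField

/-- **Granville–Stark 2000, Lemma 1 / Táfula 2021, Lemma 5.4 (polynomial root-discriminant form)**
— CHILD fact of the split of `OWeakUniformABCImpliesNoSiegelZeros`. There are constants `B, E, d₁`
such that for every imaginary quadratic field `K` (`[K:ℚ] = 2`, no real place) with `|d_K| ≥ d₁`
there exist a number field `F`, an embedding `σ₀ : F → ℂ` and `u, v ∈ F` with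
`σ₀(u³) = j(τ_{d_K})` (the singular modulus of the principal form of discriminant `d_K`,
`formJ (principalForm d_K)`), `v² = u³ − 1728`, and `|D_F| ≤ (B · |d_K|^E)^{[F:ℚ]}`, i.e.
`rd_F ≤ B|d_K|^E`. In print: `F = ℚ(γ₂(τ), γ₃(τ)) ∋ √d_K, j(τ)` for a suitable `τ` of
discriminant `d_K`, `u = γ₂(τ)`, `v = γ₃(τ)` (Weber: `γ₂³ = j`, `γ₃² = j − 1728`), and
`rd_F ≤ 6√|d_K|` (so `B = 6`, `E = ½` suffice). Verbatim the hypothesis of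
`OWeakUniformABCImpliesNoSiegelZeros.of_discrBoundPoly`.
[cite: GranvilleStark2000, §2 Lemma 1] [cite: Tafula2021, Lemma 5.4 and the remark after it] -/
def GranvilleStarkLemma1Poly : Prop :=
  ∃ B E d₁ : ℝ, ∀ (K : Type) [Field K] [NumberField K],
    Module.finrank ℚ K = 2 → NumberField.InfinitePlace.nrRealPlaces K = 0 →
    d₁ ≤ |(NumberField.discr K : ℝ)| →
      ∃ (F : Type) (_ : Field F) (_ : NumberField F) (σ₀ : F →+* ℂ) (u v : F),
        σ₀ (u ^ 3) = formJ (principalForm (NumberField.discr K)) ∧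
        v ^ 2 = u ^ 3 - 1728 ∧
        |(NumberField.discr F : ℝ)| ≤
          (B * |(NumberField.discr K : ℝ)| ^ E) ^ Module.finrank ℚ F

/-- **Assembly of the split (PROVED):** the `O`-weak barrier entry
`OWeakUniformABCImpliesNoSiegelZeros` follows from its single child `GranvilleStarkLemma1Poly` —
everything else in the printed proof (Táfula 2021, §5.2; Granville–Stark 2000, §2–§3) is a theorem
of the tree (`OWeakUniformABCImpliesNoSiegelZeros.of_discrBoundPoly`).
[cite: Tafula2021, Theorem 1.2 with Lemmas 5.4–5.5] [cite: GranvilleStark2000, Theorem 2] -/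
theorem OWeakUniformABCImpliesNoSiegelZeros_holds_of (h : GranvilleStarkLemma1Poly) :
    OWeakUniformABCImpliesNoSiegelZeros :=
  OWeakUniformABCImpliesNoSiegelZeros.of_discrBoundPoly h

/-- The same child discharges the catalogued entry `UniformABCImpliesNoSiegelZeros`
(Granville–Stark 2000, Theorem 2 with the full uniform abc conjecture).
[cite: GranvilleStark2000, Theorem 2] -/
theorem UniformABCImpliesNoSiegelZeros_holds_of (h : GranvilleStarkLemma1Poly) :
    UniformABCImpliesNoSiegelZeros :=
  UniformABCImpliesNoSiegelZeros.of_oWeak (OWeakUniformABCImpliesNoSiegelZeros_holds_of h)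

/-- **Granville–Stark 2000, Lemma 1 / Táfula 2021, Lemma 5.4 (PROVED)** — the discharge of the
child `GranvilleStarkLemma1Poly`: from the unramified cube/square data of the Hilbert class field
(`exists_unramified_cubeSquare_singularModulus_all` of the Proofs file: `L = H_K ⊇ K` unramified,
`(j₀) = 𝔞³`, `(j₀ − 1728) = 𝔟²`), `|d_L| = |d_K|^{[L:K]}`
(`natAbs_discr_eq_pow_of_forall_isUnramifiedAt`) and the Kummer tower `F = L(∛j₀, √(j₀ − 1728))`
(`exists_kummer_tower`, `|D_F| ≤ 6^{[F:ℚ]}|D_L|^{[F:L]}`): `B = 6`, `E = ½`.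
[cite: GranvilleStark2000, §2 Lemma 1] [cite: Tafula2021, Lemma 5.4] -/
theorem GranvilleStarkLemma1Poly_holds : GranvilleStarkLemma1Poly := by
  obtain ⟨d₁, hH⟩ := exists_unramified_cubeSquare_singularModulus_all
  refine ⟨6 * 1, 1 / 2, d₁, fun K _ _ h2 h0 hd ↦ ?_⟩
  obtain ⟨L, instF, instNF, instA, σ, j₀, 𝔞, 𝔟, hσ, hunr, h𝔞, h𝔟⟩ := hH K h2 h0 hd
  -- `|d_L| = (|d_K|^{1/2})^{[L:ℚ]}`
  have hDL : |(NumberField.discr L : ℝ)| ≤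
      (1 * |(NumberField.discr K : ℝ)| ^ (1 / 2 : ℝ)) ^ Module.finrank ℚ L := by
    refine le_of_eq ?_
    have hdisc := Literature.NumberTheory.NumberFields.natAbs_discr_eq_pow_of_forall_isUnramifiedAt
      (K := K) (L := L) hunr
    haveI : Module.Free ℚ K := Module.Free.of_divisionRing ℚ K
    haveI : Module.Free K L := Module.Free.of_divisionRing K L
    have hdeg : Module.finrank ℚ L = 2 * Module.finrank K L := by
      rw [← h2, Module.finrank_mul_finrank]
    have h1 : |(NumberField.discr L : ℝ)| = ((NumberField.discr L).natAbs : ℝ) := by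
      rw [← Int.cast_abs, Int.abs_eq_natAbs, Int.cast_natCast]
    have h2' : |(NumberField.discr K : ℝ)| = ((NumberField.discr K).natAbs : ℝ) := by
      rw [← Int.cast_abs, Int.abs_eq_natAbs, Int.cast_natCast]
    rw [one_mul, ← Real.sqrt_eq_rpow, hdeg, pow_mul, Real.sq_sqrt (abs_nonneg _), h1, hdisc, h2']
    push_cast
    ring
  -- the Kummer tower
  obtain ⟨F, _, _, σ₀, u, v, m, hu, hv, hm, hDF⟩ :=
    Literature.NumberTheory.DiophantineGeometry.exists_kummer_tower σ j₀ 𝔞 𝔟 h𝔞 h𝔟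
  refine ⟨F, ‹_›, ‹_›, σ₀, u, v, by rw [hu, hσ], hv, ?_⟩
  have h1 : |(NumberField.discr F : ℝ)| = ((NumberField.discr F).natAbs : ℝ) := by
    rw [← Int.cast_abs, Int.abs_eq_natAbs, Int.cast_natCast]
  have h2' : |(NumberField.discr L : ℝ)| = ((NumberField.discr L).natAbs : ℝ) := by
    rw [← Int.cast_abs, Int.abs_eq_natAbs, Int.cast_natCast]
  have hDF' : ((NumberField.discr F).natAbs : ℝ) ≤
      (6 : ℝ) ^ Module.finrank ℚ F * ((NumberField.discr L).natAbs : ℝ) ^ m := by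
    exact_mod_cast hDF
  rw [h1]
  rw [h2'] at hDL
  calc ((NumberField.discr F).natAbs : ℝ)
      ≤ (6 : ℝ) ^ Module.finrank ℚ F * ((NumberField.discr L).natAbs : ℝ) ^ m := hDF'
    _ ≤ (6 : ℝ) ^ Module.finrank ℚ F *
          ((1 * |(NumberField.discr K : ℝ)| ^ (1 / 2 : ℝ)) ^ Module.finrank ℚ L) ^ m := by
        gcongr
    _ = (6 * 1 * |(NumberField.discr K : ℝ)| ^ (1 / 2 : ℝ)) ^ Module.finrank ℚ F := by
        rw [← pow_mul, ← hm]; ring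

end Literature.Barriers.ABC

end
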